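import Summits.BirchSwinnertonDyer.BirchSwinnertonDyer.Theorems.ResidualThetaTransportAtTwoSignedMuVanishingAtTwoPlusSel2

/-!
# Line `fukuda-step` for crux `SignedMuSeedAtTwoPlus` (stmt-BirchSwinnertonDyer-21438) — crux-ideate r1 k2

SIGNED FUKUDA STABILISATION. `X̄ = X⁺(A)/2X⁺(A)` is a f.g. module over `Λ/2Λ = 𝔽₂⟦T⟧` (a DVR) and
`ω_n = (1+T)^{2^n} - 1 ≡ T^{2^n} (mod 2)`, so the plus-Selmer `2`-torsion fixed by `γ^{2^n}` is the Pontryagin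
dual of `X̄/T^{2^n}X̄`, whose `𝔽₂`-dimension is `2^n · rank(X̄) + Σ min(aᵢ, 2^n)`. ONE slack step
`dim(level n+1) - dim(level n) < 2^n` forces `rank X̄ = 0`, i.e. `Sel⁺(A/ℚ_∞)[2]` finite, i.e. (tree:
`isTorsion_and_mu_eq_zero_iff_finite_selmer_pTorsion`) `X⁺(A)` torsion with `μ⁺ = 0`; conversely finiteness gives
a step at every large level (the certificate is COMPLETE). The signed-Selmer analogue at `p = 2` of Fukuda 1994
Thm 1 (tree fact `IwasawaTheory.fukuda1994_thm1_classGroupPRank_const_of_succ_eq`, class groups). Member `A := W`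
is eligible; no `L`-value, no Euler system, no Selmer-trivial / odd-Tamagawa anchor is needed. The `∀ W` half
(`stub_fukudaCertificate`) is per-class decidable and conjecture-strength uniformly — BSD is not proved by any of this.
-/

open WeierstrassCurve Literature.NumberTheory.EllipticCurves
open Literature.NumberTheory.EllipticCurves.Kobayashi2003
open Literature.NumberTheory.EllipticCurves.Rank1Residual
open Summit.BirchSwinnertonDyer.BirchSwinnertonDyer.Theses.ResidualThetaTransportAtTwo

noncomputable section

namespace Summit.BirchSwinnertonDyer.BirchSwinnertonDyer.Cruxes.SignedMuSeedAtTwoPlus.FukudaStep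

/-- Plus-Selmer `2`-torsion classes over `ℚ_∞` fixed by `γ^m`. -/
def fixedTwoTorsion (A : WeierstrassCurve ℚ) [A.IsElliptic] (κ : ZpExtension ℚ 2)
    (γ : Field.absoluteGaloisGroup ℚ) (m : ℕ) : Set (signedSelmerInfty A κ 1) :=
  {s | 2 • s = 0 ∧ ((conjSignedSelmerInfty A κ 1 γ) ^ m) s = s}

/-- STEP(n): slack one-step stabilisation between layers `n` and `n+1`. -/
def StepAt (A : WeierstrassCurve ℚ) [A.IsElliptic] (κ : ZpExtension ℚ 2)
    (γ : Field.absoluteGaloisGroup ℚ) (n : ℕ) : Prop :=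
  (fixedTwoTorsion A κ γ (2 ^ (n + 1))).Finite ∧
    Nat.card (fixedTwoTorsion A κ γ (2 ^ (n + 1))) < 2 ^ (2 ^ n) * Nat.card (fixedTwoTorsion A κ γ (2 ^ n))

/-! ## Registered stub statements (named `Prop`s; each `stub_*` proves its statement BY NAME) -/

/-- **Stub statement 1 (pure algebra, size M): rank zero from a slack step.** For a f.g. `Λ = ℤ₂⟦T⟧`-module `X` and
`m > 0`, `#(X/(2,T^{2m})X) < 2^m · #(X/(2,T^m)X)` forces `X/2X` finite (f.g. modules over the DVR `𝔽₂⟦T⟧`). -/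
def RankZeroOfSlackStep : Prop :=
  ∀ (X : Type) [AddCommGroup X] [Module (IwasawaAlgebra 2) X] [Module.Finite (IwasawaAlgebra 2) X] (m : ℕ),
    0 < m →
    Nat.card (X ⧸ (Ideal.span {PowerSeries.C (2 : ℤ_[2]), (PowerSeries.X : IwasawaAlgebra 2) ^ (2 * m)} •
        (⊤ : Submodule (IwasawaAlgebra 2) X))) <
      2 ^ m * Nat.card (X ⧸ (Ideal.span {PowerSeries.C (2 : ℤ_[2]), (PowerSeries.X : IwasawaAlgebra 2) ^ m} •
        (⊤ : Submodule (IwasawaAlgebra 2) X))) →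
    Finite (X ⧸ (IwasawaAlgebra.augIdealP 2 • (⊤ : Submodule (IwasawaAlgebra 2) X)))

/-- **Stub statement 2 (duality transport, size M–L; the HARDEST typed stub): signed Fukuda finiteness from the algebraic
core.** At a cyclotomic `(κ, γ)` with `X⁺(A)` f.g., a certified STEP(n) makes `Sel⁺(A/ℚ_∞)[2]` finite: the fixed `2`-torsion at
`γ^{2^k}` is Pontryagin dual to `D.X/(2, T^{2^k})D.X` via `D.isDualPair hγ` (`(1+T)^{2^k} - 1 ≡ T^{2^k} mod 2`), and `X/2X`
finite ⟺ `Sel⁺[2]` finite (`ThetaPartnerAtTwoSignedTransportAtTwoSelmerPontryagin.finite_quotient_augIdealP_iff_finite_pTorsion`). -/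
def FinitenessTransport : Prop :=
  RankZeroOfSlackStep →
  ∀ (A : WeierstrassCurve ℚ) [A.IsElliptic] (κ : ZpExtension ℚ 2) (γ : Field.absoluteGaloisGroup ℚ),
    κ.IsCyclotomic → κ.IsTopGenerator γ →
    (∃ D : SignedSelmerDualData A κ γ 1, Module.Finite (IwasawaAlgebra 2) D.X) →
    (∃ n, StepAt A κ γ n) → {s : signedSelmerInfty A κ 1 | 2 • s = 0}.Finite

/-- **Stub statement 3 (certificate existence; per class a finite computation, uniformly conjecture-strength):** every
habitat⁺ curve is congruent mod `2` to an admissible `A` (e.g. `A = W`) with a certified STEP(n) at some level, at every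
cyclotomic `(κ, γ)` where `X⁺(A)` is f.g. Finite-level dictionary: `fixedTwoTorsion A κ γ (2^n)` is the plus-induced
`2`-Selmer group of `A` over `ℚ_n` (exact mod-`2` control since `A(ℚ_∞)[2] = 0`), sandwiched by computable Selmer conditions
up to the INJ⁺/K4 control error at `2` and Néron kernels at bad primes. -/
def FukudaCertificate : Prop :=
  ∀ (W : WeierstrassCurve ℚ) [W.IsElliptic] [W.IsGloballyMinimal], ¬ W.HasCM → W.analyticRank = 0 →
    GoodSS W 2 → W.frobeniusTrace 2 = 0 → W.Δ < 0 →
    ∃ (A : WeierstrassCurve ℚ) (_ : A.IsElliptic) (_ : A.IsGloballyMinimal), GoodSS A 2 ∧ A.frobeniusTrace 2 = 0 ∧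
      (∃ e : WeierstrassCurve.geomTorsion W (2 : ℤ) ≃+ WeierstrassCurve.geomTorsion A (2 : ℤ),
        ∀ (σ : Field.absoluteGaloisGroup ℚ) (P : WeierstrassCurve.geomTorsion W (2 : ℤ)), e (σ • P) = σ • e P) ∧
      ∀ (κ : ZpExtension ℚ 2) (γ : Field.absoluteGaloisGroup ℚ), κ.IsCyclotomic → κ.IsTopGenerator γ →
        (∃ D' : SignedSelmerDualData A κ γ 1, Module.Finite (IwasawaAlgebra 2) D'.X) → ∃ n, StepAt A κ γ n

theorem stub_rankZeroOfSlackStep : RankZeroOfSlackStep := by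
  sorry

theorem stub_finitenessTransport : FinitenessTransport := by
  sorry

theorem stub_fukudaCertificate : FukudaCertificate := by
  sorry

/-! ## Assembly (sorry-free glue) and the registrar theorem -/

/-- GLUE (no sorry): the three stub statements give the crux, through the tree's SEL2-seed door
`Theorems.SignedMuAtTwo.signedMuSeedAtTwoPlus_of_sel2Seed` (p580570). -/
theorem SignedMuSeedAtTwoPlus_of_stubs (halg : RankZeroOfSlackStep) (hfin : FinitenessTransport)
    (hcert : FukudaCertificate) : SignedMuSeedAtTwoPlus := by
  refine Theorems.SignedMuAtTwo.signedMuSeedAtTwoPlus_of_sel2Seed ?_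
  intro W _ _ hCM hr hss ha hΔ
  obtain ⟨A, hA, hA', hssA, haA, hiso, hc⟩ := hcert W hCM hr hss ha hΔ
  exact ⟨A, hA, hA', hssA, haA, hiso, fun κ γ hκ hγ hfg ↦ hfin halg A κ γ hκ hγ hfg (hc κ γ hκ hγ hfg)⟩

/-- **THE SKELETON THEOREM (registrar shape): the crux BY NAME from the declared stubs**; the only `sorry`s in its
closure are the three `stub_*` theorems. -/
theorem SignedMuSeedAtTwoPlus_of :
    Summit.BirchSwinnertonDyer.BirchSwinnertonDyer.Theses.ResidualThetaTransportAtTwo.SignedMuSeedAtTwoPlus :=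
  SignedMuSeedAtTwoPlus_of_stubs stub_rankZeroOfSlackStep stub_finitenessTransport stub_fukudaCertificate

end Summit.BirchSwinnertonDyer.BirchSwinnertonDyer.Cruxes.SignedMuSeedAtTwoPlus.FukudaStep

end
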